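import Summits.RiemannHypothesis.RiemannHypothesis.Theorems.AsymptoticCriticalLine.Negative.BandForms

/-!
# `AsymptoticCriticalLine` (crux `stmt-RiemannHypothesis-2063`, route `RuelleBand`):
# product calculus and the completed form (negative-side support, cycle 2)

Support file of the crux disprover (cdisprove seat refuter-cdisprove-stmt-RiemannHypothesis-2063-g2-0),
companion of `BandForms.lean` (`bandSet Z ε`). Information for the prover:

* `bandSet_mul`, `band_mul_iff`: bands of a product are unions of bands, so the band shape
  `∀ ε > 0, (bandSet Z ε).Finite` is multiplicative — INHERITED BY FACTORS (proving it for any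
  function divisible by `ζ` in the strip, e.g. a Dedekind zeta function `ζ_K = ζ · ∏ L(s, χ)` of an
  abelian extension, proves the crux) and preserved under products;
* `band_congr`: the shape only sees the zero set in the open strip;
* `acl_iff_completedRiemannZeta`: the crux ⟺ the band shape of Mathlib's completed zeta function
  `Λ = π^{−s/2} Γ(s/2) ζ` (`ζ = Λ/Γ_ℝ`, `Γ_ℝ ≠ 0` in the strip) — the natural output of a
  functional-equation-symmetric / spectral construction.
-/

noncomputable section

namespace Summit.RiemannHypothesis.RiemannHypothesis.Theorems.AsymptoticCriticalLine.Negative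

open Complex Set
open Summit.RiemannHypothesis.RiemannHypothesis.Theses.RuelleBand (AsymptoticCriticalLine)

/-- Bands of a product are unions of bands. [folklore] -/
theorem bandSet_mul (Z W : ℂ → ℂ) (ε : ℝ) :
    bandSet (fun s => Z s * W s) ε = bandSet Z ε ∪ bandSet W ε := by
  ext s
  simp only [bandSet, mem_setOf_eq, mem_union, mul_eq_zero]
  tauto

/-- The band shape is multiplicative: `Z·W` has it iff both factors do. [folklore] -/
theorem band_mul_iff (Z W : ℂ → ℂ) :
    (∀ ε : ℝ, 0 < ε → (bandSet (fun s => Z s * W s) ε).Finite) ↔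
      (∀ ε : ℝ, 0 < ε → (bandSet Z ε).Finite) ∧ ∀ ε : ℝ, 0 < ε → (bandSet W ε).Finite := by
  simp only [bandSet_mul, Set.finite_union]
  exact ⟨fun h => ⟨fun ε hε => (h ε hε).1, fun ε hε => (h ε hε).2⟩,
    fun h ε hε => ⟨h.1 ε hε, h.2 ε hε⟩⟩

/-- The band shape only sees the zero set inside the open strip. [folklore] -/
theorem band_congr {Z W : ℂ → ℂ}
    (h : ∀ s : ℂ, 0 < s.re → s.re < 1 → (Z s = 0 ↔ W s = 0)) :
    (∀ ε : ℝ, 0 < ε → (bandSet Z ε).Finite) ↔ ∀ ε : ℝ, 0 < ε → (bandSet W ε).Finite := by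
  have hset : ∀ ε, bandSet Z ε = bandSet W ε := fun ε => by
    ext s
    simp only [bandSet, mem_setOf_eq]
    constructor
    · rintro ⟨hz, h0, h1, hε⟩; exact ⟨(h s h0 h1).1 hz, h0, h1, hε⟩
    · rintro ⟨hz, h0, h1, hε⟩; exact ⟨(h s h0 h1).2 hz, h0, h1, hε⟩
  simp only [hset]

/-- COMPLETED FORM: the crux is equivalently the band shape of Mathlib's completed zeta function
`Λ(s) = π^{−s/2} Γ(s/2) ζ(s)` (`completedRiemannZeta`; in the open strip `ζ = Λ / Γ_ℝ` with
`Γ_ℝ ≠ 0`: Mathlib `riemannZeta_def_of_ne_zero`, `Gammaℝ_ne_zero_of_re_pos`). [folklore] -/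
theorem acl_iff_completedRiemannZeta :
    AsymptoticCriticalLine ↔ ∀ ε : ℝ, 0 < ε → (bandSet completedRiemannZeta ε).Finite := by
  rw [acl_iff_bandSet]
  refine band_congr fun s h0 _ => ?_
  have hs0 : s ≠ 0 := fun h => by rw [h, zero_re] at h0; exact lt_irrefl _ h0
  rw [riemannZeta_def_of_ne_zero hs0, div_eq_zero_iff, or_iff_left (Gammaℝ_ne_zero_of_re_pos h0)]

end Summit.RiemannHypothesis.RiemannHypothesis.Theorems.AsymptoticCriticalLine.Negative

end
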